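import Summits.ResolutionOfSingularities.ResolutionOfSingularities.Theorems.HilbertSamuelEliminationSigmaMaxModificationsCorridor3SigmaCyclePlusBoundaryDefs
import Summits.ResolutionOfSingularities.ResolutionOfSingularities.Theorems.HilbertSamuelEliminationSigmaMaxModificationsCorridor3SigmaCyclePlusScope
import HarnessLib

/-!
# [OURS · L1 W4.2] σ-LAYER — the CENTRE and CYCLE PACKAGES over the boundary-threaded END-rule variant Ω⁺E, and the cycle invariant along
# Ω⁺E-chains (transport of res-type-040's Ω⁺ packages p524329 / `CycleInvPlus` p525xxx to `IsCanonicalStepΩplusE` of p525032)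
# (cell res-hironaka, LADDER-RESOLUTION rung L; slot W4.2, crux chain w42 `SigmaMaxModificationsCorridor3` stmt-ResolutionOfSingularities-19249;
# `--supports stmt-ResolutionOfSingularities-19249 --as helper`; res-L1-w42-plan-1 RULING v3.14-14 (DM) 10:54:26Z; hand res-D-brk-3 (gen 5);
# single writer of the Ω⁺ family = res-type-040 (this is a SIBLING transport file, nothing of 040's is restated); consumer res-D-pv-047 (E5)(γ))

THE TRANSPORT DEVICE. The Ω⁺ packages (`isCanonicalStepΩplus_centre_package`, `isCanonicalStepΩplus_cycle_package`, p524329) use the stage oracle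
ONLY through admissibility («every named sequence has regular centres and a regular last stage»), never through functionality. A
boundary-reading stage oracle `ω : StageOracleE` (res-D-pv-047's p523856) therefore transports through the BOUNDARY-FORGETTING blind oracle
«`t` is named on `(W, L, S, φ)` for SOME boundary `E`» — written INLINE as an anonymous `StageOracle` (no new `def`): an Ω⁺E-step is an
Ω⁺-step of that blind oracle (`isCanonicalStepΩplus_forget_of_isCanonicalStepΩplusE`), and Ω⁺E-admissibility of `ω` is Ω⁺-admissibility of it
(`oracleAdmissibleΩplus_forget`). (The forgetting oracle is NOT functional — that is o1's finding (CL) and the reason Ω⁺E exists — but the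
packages do not need functionality.) Hence every conclusion of the Ω⁺ packages holds verbatim for Ω⁺E-steps, for every boundary `E`, and
`CycleInvPlus` (040's invariant on the underlying marked stage, p52xxxx `…SigmaCyclePlusScope`) propagates along `CanonicalNearStepσE
(StrategyE.ofStageOraclePlusE ω)`; the BOUNDARY CLAUSE of a boundary-threaded step — the next boundary is `E.next C` — is definitional in
`CanonicalNearStepσE` (part 1c, p523041) and is recorded here as `CanonicalNearStepσE.length_E` (one member more per step).

Contents (namespace `…Theorems.SigmaMaxModificationsCorridor3.Sigma`): `isCanonicalStepΩplus_forget_of_isCanonicalStepΩplusE`,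
`oracleAdmissibleΩplus_forget`, **`isCanonicalStepΩplusE_centre_package`**, **`isCanonicalStepΩplusE_cycle_package`**, `CycleInvPlus.centreE`,
`CycleInvPlus.stepE`, `CycleInvPlus.of_reachesE`, `reachesσE_chain`, **`exists_cycleInvPlus_chainE`**, `CanonicalNearStepσE.length_E`.
Every `theorem` PROVED; 0 `def`s. OURS (cell res-hironaka, slot W4.2); NOT statements of H. Hironaka's manuscript [Hironaka2017] nor of
[CossartJannsenSaito2020]; AI-written, weaker than expert review. References: CJS LNM 2270 Rem. 6.29 (1) p. 92, Thm. 3.3, Thm. 3.10 (1)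
[CossartJannsenSaito2020]; tree p523041 (`…SigmaBoundaryDefs`), p523856 (`…SigmaBoundaryRuns`), p523517/p524329/p525032 (Ω⁺, Ω⁺ packages, Ω⁺E).
-/

noncomputable section

set_option linter.dupNamespace false

open CategoryTheory AlgebraicGeometry TopologicalSpace Topology
open Summit.ResolutionOfSingularities.ResolutionOfSingularities.Theorems.CampaignW42
open Literature.AlgebraicGeometry.Resolution Literature.RingTheory.HilbertSamuel
open Summit.ResolutionOfSingularities.ResolutionOfSingularities.Theorems.SigmaMaxModificationsCorridor3

namespace Summit.ResolutionOfSingularities.ResolutionOfSingularities.Theorems.SigmaMaxModificationsCorridor3.Sigma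

universe u

variable {ω : StageOracleE.{u}} {N : ℕ} {ν : ℕ → ℕ}

/-! ## §1. Forgetting the boundary: an Ω⁺E-step is an Ω⁺-step of the blind oracle «named for SOME boundary» -/

/-- **An Ω⁺E-step of `ω` at the boundary `E` is an Ω⁺-step of the boundary-FORGETTING blind oracle** `(W, L, S, φ, t) ↦ ∃ E, ω.namesE … E … t`
(written inline; each case by unfolding). [folklore] -/
theorem isCanonicalStepΩplus_forget_of_isCanonicalStepΩplusE {W : Scheme.{u}} {hW : IsLocallyNoetherian W} {L : Labelling W}
    {E : Boundary W} {P : Option (Pending W)} {C : W.IdealSheafData} {P' : Option (Pending (blowup C))}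
    (h : IsCanonicalStepΩplusE ω hW N ν L E P C P') :
    IsCanonicalStepΩplus ⟨fun W hW N ν L S φ t => ∃ E : Boundary W, ω.namesE W hW N ν L E S φ t⟩ hW N ν L P C P' := by
  cases P with
  | none =>
    obtain ⟨j, hj, hcl, t, hR, hs⟩ := h
    exact ⟨j, hj, hcl, t, ⟨E, hR⟩, hs⟩
  | some Q => exact h

/-- **Ω⁺E-admissibility of `ω` is Ω⁺-admissibility of the boundary-forgetting blind oracle.** [folklore] -/
theorem oracleAdmissibleΩplus_forget (hω : OracleAdmissibleΩplusE ω) :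
    OracleAdmissibleΩplus ⟨fun W hW N ν L S φ t => ∃ E : Boundary W, ω.namesE W hW N ν L E S φ t⟩ :=
  fun W hW N ν L S φ t ⟨E, hE⟩ => hω W hW N ν L E S φ t hE

/-! ## §2. The centre and cycle packages over Ω⁺E -/

/-- **ONE Ω⁺E STEP FROM A STATE OVER `k` — CENTRE PACKAGE** (res-type-040's `isCanonicalStepΩplus_centre_package` transported; any
boundary `E`): a REGULAR centre of an Ω⁺E step lies in the stratum, is PERMISSIBLE, `H^N` does not increase along its blow-up, and the
geometric state propagates. [cite: CossartJannsenSaito2020, Rem. 6.29 (1), Thm. 3.3, Thm. 3.10 (1)] -/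
theorem isCanonicalStepΩplusE_centre_package {k : Type u} [Field k] (hν : ν ≠ iterPSum N Phi) {W : Scheme.{u}}
    (hW : IsLocallyNoetherian W) {L : Labelling W} {E : Boundary W} {P : Option (Pending W)}
    (hk : ∃ f : W ⟶ Spec (.of k), LocallyOfFiniteType f ∧ QuasiCompact f)
    (hred : IsReduced W) (hdim : topologicalKrullDim W ≤ (N : WithBot ℕ∞))
    (hsup : ∀ w : W, ν ≤ Scheme.hsFun W N w → Scheme.hsFun W N w = ν)
    (hinv : ∀ Q, P = some Q → Set.range Q.hom.base ⊆ Scheme.hsStratum W N ν)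
    {C : W.IdealSheafData} {P' : Option (Pending (blowup C))} (hst : IsCanonicalStepΩplusE ω hW N ν L E P C P')
    (hCreg : Literature.AlgebraicGeometry.Resolution.Scheme.IsRegular C.subscheme) :
    (C.support : Set W) ⊆ Scheme.hsStratum W N ν ∧ IdealSheafData.IsPermissible C ∧
      (∀ z : ↥(blowup C), Scheme.hsFun (blowup C) N z ≤ Scheme.hsFun W N ((blowup.π C).base z)) ∧
      (∃ f' : blowup C ⟶ Spec (.of k), LocallyOfFiniteType f' ∧ QuasiCompact f') ∧ IsReduced (blowup C) ∧
      topologicalKrullDim (blowup C) ≤ (N : WithBot ℕ∞) ∧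
      (∀ z : ↥(blowup C), ν ≤ Scheme.hsFun (blowup C) N z → Scheme.hsFun (blowup C) N z = ν) ∧
      ∀ Q', P' = some Q' → Set.range Q'.hom.base ⊆ Scheme.hsStratum (blowup C) N ν :=
  isCanonicalStepΩplus_centre_package hν hW hk hred hdim hsup hinv (isCanonicalStepΩplus_forget_of_isCanonicalStepΩplusE hst) hCreg

/-- **ONE Ω⁺E STEP UNDER THE (WEAK) CYCLE INVARIANT, Ω⁺E-ADMISSIBLE BOUNDARY-READING ORACLE** (res-type-040's
`isCanonicalStepΩplus_cycle_package` transported; any boundary `E`): the Ω⁺E centre is regular, lies in the stratum, is permissible, `H^N`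
does not increase, and the weak pending invariant holds at the next state. [cite: CossartJannsenSaito2020, Rem. 6.29 (1), p. 92, Thm. 3.3] -/
theorem isCanonicalStepΩplusE_cycle_package {k : Type u} [Field k] (hω : OracleAdmissibleΩplusE ω) (hν : ν ≠ iterPSum N Phi)
    {W : Scheme.{u}} (hW : IsLocallyNoetherian W) {L : Labelling W} {E : Boundary W} {P : Option (Pending W)}
    (hk : ∃ f : W ⟶ Spec (.of k), LocallyOfFiniteType f ∧ QuasiCompact f)
    (hred : IsReduced W) (hdim : topologicalKrullDim W ≤ (N : WithBot ℕ∞))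
    (hsup : ∀ w : W, ν ≤ Scheme.hsFun W N w → Scheme.hsFun W N w = ν) (hlab : ∀ Z, L.label Z ≤ L.year)
    (hpend : ∀ Q, P = some Q → Set.range Q.hom.base ⊆ Scheme.hsStratum W N ν ∧ Q.lbl ≤ L.year ∧
      Q.rest.AllRegular ∧ Literature.AlgebraicGeometry.Resolution.Scheme.IsRegular Q.rest.top)
    {C : W.IdealSheafData} {P' : Option (Pending (blowup C))} (hst : IsCanonicalStepΩplusE ω hW N ν L E P C P') :
    Literature.AlgebraicGeometry.Resolution.Scheme.IsRegular C.subscheme ∧ (C.support : Set W) ⊆ Scheme.hsStratum W N ν ∧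
      IdealSheafData.IsPermissible C ∧
      (∀ z : ↥(blowup C), Scheme.hsFun (blowup C) N z ≤ Scheme.hsFun W N ((blowup.π C).base z)) ∧
      (∃ f' : blowup C ⟶ Spec (.of k), LocallyOfFiniteType f' ∧ QuasiCompact f') ∧ IsReduced (blowup C) ∧
      topologicalKrullDim (blowup C) ≤ (N : WithBot ℕ∞) ∧
      (∀ z : ↥(blowup C), ν ≤ Scheme.hsFun (blowup C) N z → Scheme.hsFun (blowup C) N z = ν) ∧
      (∀ Z, (L.next (Scheme.hsStratum W N ν) C).label Z ≤ (L.next (Scheme.hsStratum W N ν) C).year) ∧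
      ∀ Q', P' = some Q' →
        Set.range Q'.hom.base ⊆ Scheme.hsStratum (blowup C) N ν ∧
          Q'.lbl ≤ (L.next (Scheme.hsStratum W N ν) C).year ∧ Q'.rest.AllRegular ∧
          Literature.AlgebraicGeometry.Resolution.Scheme.IsRegular Q'.rest.top :=
  isCanonicalStepΩplus_cycle_package (oracleAdmissibleΩplus_forget hω) hν hW hk hred hdim hsup hlab hpend
    (isCanonicalStepΩplus_forget_of_isCanonicalStepΩplusE hst)

/-! ## §3. The cycle invariant along Ω⁺E-chains (`CycleInvPlus` on the underlying marked stages) -/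

namespace CycleInvPlus

variable {k : Type u} [Field k] {s s' : MarkedStageE.{u}}

/-- **THE Ω⁺E CENTRE UNDER THE INVARIANT** (Ω⁺E-admissible boundary-reading oracle, `ν ≠ Φ^{(N)}`): regular, inside `X_n(ν)`, PERMISSIBLE,
and `H^N` does not increase along its blow-up. [cite: CossartJannsenSaito2020, Rem. 6.29 (1), Thm. 3.3, Thm. 3.10 (1)] -/
theorem centreE (hω : OracleAdmissibleΩplusE ω) (hν : ν ≠ iterPSum N Phi) (h : CycleInvPlus k N ν s.toMarkedStage)
    {C : s.W.IdealSheafData} {P' : Option (Pending (blowup C))} (hcs : IsCanonicalStepΩplusE ω s.ln N ν s.L s.E s.P C P') :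
    Literature.AlgebraicGeometry.Resolution.Scheme.IsRegular C.subscheme ∧ (C.support : Set s.W) ⊆ Scheme.hsStratum s.W N ν ∧
      IdealSheafData.IsPermissible C ∧
      ∀ z : ↥(blowup C), Scheme.hsFun (blowup C) N z ≤ Scheme.hsFun s.W N ((blowup.π C).base z) := by
  obtain ⟨h1, h2, h3, h4, -⟩ :=
    isCanonicalStepΩplusE_cycle_package (k := k) hω hν s.ln h.overField h.isReduced h.dim_le h.supMax h.label_le_year h.pending hcs
  exact ⟨h1, h2, h3, h4⟩

/-- **THE INVARIANT PROPAGATES ALONG Ω⁺E-STEPS** followed at the marked points (the boundary is carried along as `E.next C`, on which the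
invariant puts no condition). [cite: CossartJannsenSaito2020, Rem. 6.29 (1), p. 92] -/
theorem stepE (hω : OracleAdmissibleΩplusE ω) (hν : ν ≠ iterPSum N Phi) (h : CycleInvPlus k N ν s.toMarkedStage)
    (hst : CanonicalNearStepσE (StrategyE.ofStageOraclePlusE ω) N ν s s') : CycleInvPlus k N ν s'.toMarkedStage := by
  obtain ⟨C, P', hln, x', hcs, -, -, -, rfl⟩ := hst
  obtain ⟨-, -, -, -, hk', hred', hdim', hsup', hlab', hpend'⟩ :=
    isCanonicalStepΩplusE_cycle_package (k := k) hω hν s.ln h.overField h.isReduced h.dim_le h.supMax h.label_le_year h.pending hcs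
  exact ⟨hk', hred', hdim', hsup', hlab', hpend'⟩

/-- … and along `ReachesσE`. [folklore] -/
theorem of_reachesE (hω : OracleAdmissibleΩplusE ω) (hν : ν ≠ iterPSum N Phi) (h : CycleInvPlus k N ν s.toMarkedStage)
    (hr : ReachesσE (StrategyE.ofStageOraclePlusE ω) N ν s s') : CycleInvPlus k N ν s'.toMarkedStage := by
  induction hr with
  | refl => exact h
  | tail _ hlast ih => exact ih.stepE hω hν hlast

end CycleInvPlus

/-- Along a chain of boundary-threaded σ-steps whose start is reached from `s₀`, every term is reached from `s₀`. [folklore] -/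
theorem reachesσE_chain {σ : StrategyE.{u}} {s₀ : MarkedStageE.{u}} {c : ℕ → MarkedStageE.{u}} (h0 : ReachesσE σ N ν s₀ (c 0))
    (hstep : ∀ n, CanonicalNearStepσE σ N ν (c n) (c (n + 1))) (n : ℕ) : ReachesσE σ N ν s₀ (c n) := by
  induction n with
  | zero => exact h0
  | succ n ih => exact ih.tail (hstep n)

/-- **Along an Ω⁺E-chain from a maximal origin (any initial boundary `E₀`) with `ν ≠ Φ^{(N)}` every stage is under the invariant.**
[cite: CossartJannsenSaito2020, Rem. 6.29 (1)] -/
theorem exists_cycleInvPlus_chainE {p : ℕ} (hω : OracleAdmissibleΩplusE ω) (hν : ν ≠ iterPSum N Phi) {X : Scheme.{u}}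
    [IsLocallyNoetherian X] {x : X} (hX : IsMaximalOrigin p N ν X x) (E₀ : Boundary X) {c : ℕ → MarkedStageE.{u}}
    (h0 : ReachesσE (StrategyE.ofStageOraclePlusE ω) N ν (MarkedStageE.init X x E₀) (c 0))
    (hstep : ∀ n, CanonicalNearStepσE (StrategyE.ofStageOraclePlusE ω) N ν (c n) (c (n + 1))) :
    ∃ (k : Type u) (_ : Field k), ∀ n, CycleInvPlus k N ν (c n).toMarkedStage := by
  obtain ⟨k, _, hinit⟩ := hX.exists_cycleInvPlus (N := N) (ν := ν)
  refine ⟨k, inferInstance, fun n => ?_⟩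
  have h := (show CycleInvPlus k N ν (MarkedStageE.init X x E₀).toMarkedStage from hinit).of_reachesE hω hν
    (reachesσE_chain h0 hstep n)
  exact h

/-! ## §4. The boundary clause -/

/-- **THE BOUNDARY CLAUSE of a boundary-threaded step**: the next boundary is `E.next C` (definitional in `CanonicalNearStepσE`), so it has
exactly one member more. [folklore] -/
theorem CanonicalNearStepσE.length_E {σ : StrategyE.{u}} {s s' : MarkedStageE.{u}} (h : CanonicalNearStepσE σ N ν s s') :
    s'.E.length = s.E.length + 1 := by
  obtain ⟨C, P', hln, x', -, -, -, -, rfl⟩ := h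
  exact Boundary.length_next s.E C

end Summit.ResolutionOfSingularities.ResolutionOfSingularities.Theorems.SigmaMaxModificationsCorridor3.Sigma

end
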